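import Mathlib
import Summits.CriticalPhenomena.SAWScalingLimit.Theorems.SAWTowerCountPoissonKernelExpansionHelpers

/-!
# Route SAWTowerCount · support `PoissonKernelExpansion` — the series step

Fourth-order expansion in `q = e^{-π m}` of the Poisson excursion kernel of the rectangle
`(0,m) × (0,1)` between its two ends,
`H_m(y,y') = Σ_{k ≥ 1} k sin(kπy) sin(kπy') / sinh(kπm)`,
uniformly in `y, y'` for `m ≥ 1`:
`H = 2q s s' (1 + q²) + 4 q² s₂ s₂' + 6 q³ s₃ s₃' + O(q⁴)` with `s_j = sin(jπy)`, `s_j' = sin(jπy')`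
and the explicit constant `64`.  Ingredients: `1/sinh x = 2e^{-x} + 2e^{-3x} + O(e^{-5x})`
(helpers file) for the three leading terms and a dominated tail `Σ_{k ≥ 4} 4k q^k ≤ 40 q⁴`
(`tsum_of_norm_bounded` against `Σ n qⁿ`, `Σ qⁿ`).  Serves item stmt-CriticalPhenomena-7258.
-/

namespace Summit.CriticalPhenomena.SAWScalingLimit.Theorems

open Real

/-- `e^{-π m} ≤ 1/4` for `m ≥ 1` (from `x + 1 ≤ eˣ` and `π > 3`). -/
theorem exp_neg_pi_mul_le_quarter {m : ℝ} (hm : 1 ≤ m) : Real.exp (-Real.pi * m) ≤ 1 / 4 := by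
  have hpi3 := Real.pi_gt_three
  have h1 := Real.add_one_le_exp (Real.pi * m)
  have h2 : Real.exp (-Real.pi * m) * Real.exp (Real.pi * m) = 1 := by
    rw [← Real.exp_add]
    simp
  have h3 : (4 : ℝ) ≤ Real.pi * m + 1 := by nlinarith
  have hE : 0 < Real.exp (Real.pi * m) := Real.exp_pos _
  have hq : 0 < Real.exp (-Real.pi * m) := Real.exp_pos _
  nlinarith

/-- The Poisson excursion kernel series, expanded to fourth order in `q = e^{-π m}`, uniformly in
`y, y'`: for `m ≥ 1`,
`|Σ_{k≥1} k sin(kπy) sin(kπy') / sinh(kπm) - [2q s s'(1+q²) + 4q² s₂ s₂' + 6 q³ s₃ s₃']| ≤ 64 q⁴`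
(`s_j = sin(jπy)`, `s_j' = sin(jπy')`). -/
theorem poissonKernel_series_expansion (m y y' : ℝ) (hm : 1 ≤ m) :
    |(∑' k : ℕ, ((k : ℝ) + 1) * Real.sin (((k : ℝ) + 1) * Real.pi * y) *
        Real.sin (((k : ℝ) + 1) * Real.pi * y') / Real.sinh (((k : ℝ) + 1) * Real.pi * m)) -
      (2 * Real.exp (-Real.pi * m) * Real.sin (Real.pi * y) * Real.sin (Real.pi * y') *
          (1 + Real.exp (-Real.pi * m) ^ 2) +
        4 * Real.exp (-Real.pi * m) ^ 2 * Real.sin (2 * (Real.pi * y)) *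
          Real.sin (2 * (Real.pi * y')) +
        6 * Real.exp (-Real.pi * m) ^ 3 * Real.sin (3 * (Real.pi * y)) *
          Real.sin (3 * (Real.pi * y')))| ≤
      64 * Real.exp (-Real.pi * m) ^ 4 := by
  have hq4 : Real.exp (-Real.pi * m) ≤ 1 / 4 := exp_neg_pi_mul_le_quarter hm
  set q := Real.exp (-Real.pi * m) with hq
  have hq0 : 0 < q := Real.exp_pos _
  have hpi := Real.pi_pos
  have hq1 : q < 1 := by linarith
  have hqle1 : q ≤ 1 := hq1.le
  have hqsq : q ^ 2 ≤ 1 / 2 := by nlinarith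
  set f : ℕ → ℝ := fun k => ((k : ℝ) + 1) * Real.sin (((k : ℝ) + 1) * Real.pi * y) *
        Real.sin (((k : ℝ) + 1) * Real.pi * y') / Real.sinh (((k : ℝ) + 1) * Real.pi * m) with hf
  -- facts about the k-th argument
  have hx : ∀ k : ℕ, 0 < ((k : ℝ) + 1) * Real.pi * m := fun k => by positivity
  have hexp : ∀ k : ℕ, Real.exp (-(((k : ℝ) + 1) * Real.pi * m)) = q ^ (k + 1) :=
    fun k => exp_neg_succ_mul k Real.pi m
  have hqk : ∀ k : ℕ, q ^ (k + 1) ≤ q := fun k => by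
    calc q ^ (k + 1) = q ^ k * q := pow_succ q k
      _ ≤ 1 * q := by gcongr; exact pow_le_one₀ hq0.le hqle1
      _ = q := one_mul q
  have ht2 : ∀ k : ℕ, Real.exp (-(((k : ℝ) + 1) * Real.pi * m)) ^ 2 ≤ 1 / 2 := fun k => by
    rw [hexp]
    calc (q ^ (k + 1)) ^ 2 ≤ q ^ 2 := by gcongr; exact hqk k
      _ ≤ 1 / 2 := hqsq
  -- term bound
  have hterm : ∀ k : ℕ, |f k| ≤ 4 * ((k : ℝ) + 1) * q ^ (k + 1) := fun k => by
    obtain ⟨hpos, hle⟩ := inv_sinh_le (hx k) (ht2 k)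
    rw [hexp] at hle
    simp only [hf, div_eq_mul_inv, abs_mul]
    rw [abs_of_pos hpos, abs_of_nonneg (by positivity : (0:ℝ) ≤ (k:ℝ) + 1)]
    have hs1 := Real.abs_sin_le_one (((k : ℝ) + 1) * Real.pi * y)
    have hs2 := Real.abs_sin_le_one (((k : ℝ) + 1) * Real.pi * y')
    calc ((k : ℝ) + 1) * |Real.sin (((k : ℝ) + 1) * Real.pi * y)| *
          |Real.sin (((k : ℝ) + 1) * Real.pi * y')| * (Real.sinh (((k : ℝ) + 1) * Real.pi * m))⁻¹
        ≤ ((k : ℝ) + 1) * 1 * 1 * (4 * q ^ (k + 1)) := by gcongr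
      _ = 4 * ((k : ℝ) + 1) * q ^ (k + 1) := by ring
  -- tail: dominated by 4 (i+4) q^(i+4), whose sum is explicit
  have hgeom1 := hasSum_coe_mul_geometric_of_norm_lt_one (r := q)
    (by rw [Real.norm_eq_abs, abs_of_pos hq0]; exact hq1)
  have hgeom0 := hasSum_geometric_of_lt_one hq0.le hq1
  have hg : HasSum (fun i : ℕ => 4 * ((i : ℝ) + 4) * q ^ (i + 4))
      (4 * q ^ 4 * (q / (1 - q) ^ 2 + 4 * (1 - q)⁻¹)) := by
    have := (hgeom1.add (hgeom0.mul_left 4)).mul_left (4 * q ^ 4)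
    have heq : (fun i : ℕ => 4 * ((i : ℝ) + 4) * q ^ (i + 4)) =
        fun i : ℕ => 4 * q ^ 4 * ((i : ℝ) * q ^ i + 4 * q ^ i) := by
      funext i
      ring
    rw [heq]
    exact this
  have htailb : ∀ i : ℕ, ‖f (i + 3)‖ ≤ 4 * ((i : ℝ) + 4) * q ^ (i + 4) := fun i => by
    rw [Real.norm_eq_abs]
    have := hterm (i + 3)
    push_cast at this
    calc |f (i + 3)| ≤ 4 * ((i : ℝ) + 3 + 1) * q ^ (i + 3 + 1) := this
      _ = 4 * ((i : ℝ) + 4) * q ^ (i + 4) := by ring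
  have htail : |∑' i : ℕ, f (i + 3)| ≤ 40 * q ^ 4 := by
    have h := tsum_of_norm_bounded hg htailb
    rw [Real.norm_eq_abs] at h
    refine h.trans ?_
    have hA : q / (1 - q) ^ 2 ≤ 2 := by
      rw [div_le_iff₀ (by nlinarith)]
      nlinarith
    have hB : 4 * (1 - q)⁻¹ ≤ 8 := by
      rw [← div_eq_mul_inv, div_le_iff₀ (by linarith)]
      nlinarith
    have hq4' : 0 ≤ q ^ 4 := by positivity
    nlinarith
  -- summability and splitting off the first three terms
  have hsum3 : Summable (fun i => f (i + 3)) :=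
    Summable.of_norm_bounded hg.summable htailb
  have hsum : Summable f := (summable_nat_add_iff 3).mp hsum3
  have hsplit := hsum.sum_add_tsum_nat_add 3
  have hdecomp : ∑' k, f k = f 0 + f 1 + f 2 + ∑' i, f (i + 3) := by
    rw [← hsplit, Finset.sum_range_succ, Finset.sum_range_succ, Finset.sum_range_succ,
      Finset.sum_range_zero, zero_add]
  -- the three leading terms
  have hf0 : f 0 = Real.sin (Real.pi * y) * Real.sin (Real.pi * y') *
      (Real.sinh (Real.pi * m))⁻¹ := by
    simp only [hf]
    push_cast
    ring_nf
  have hf1 : f 1 = 2 * Real.sin (2 * (Real.pi * y)) * Real.sin (2 * (Real.pi * y')) *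
      (Real.sinh (2 * (Real.pi * m)))⁻¹ := by
    simp only [hf]
    push_cast
    ring_nf
  have hf2 : f 2 = 3 * Real.sin (3 * (Real.pi * y)) * Real.sin (3 * (Real.pi * y')) *
      (Real.sinh (3 * (Real.pi * m)))⁻¹ := by
    simp only [hf]
    push_cast
    ring_nf
  have hq' : Real.exp (-(Real.pi * m)) = q := by rw [hq, neg_mul]
  have hq2 : Real.exp (-(2 * (Real.pi * m))) = q ^ 2 := by
    rw [hq, ← Real.exp_nat_mul]; congr 1; push_cast; ring
  have hq3 : Real.exp (-(3 * (Real.pi * m))) = q ^ 3 := by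
    rw [hq, ← Real.exp_nat_mul]; congr 1; push_cast; ring
  have hr0 := abs_inv_sinh_sub_sub_le (x := Real.pi * m) (by positivity) (by rw [hq']; exact hqsq)
  rw [hq'] at hr0
  have hqpow : ∀ {i j : ℕ}, i ≤ j → q ^ j ≤ q ^ i := fun hij =>
    pow_le_pow_of_le_one hq0.le hqle1 hij
  have hr1 := abs_inv_sinh_sub_le (x := 2 * (Real.pi * m)) (by positivity)
    (by rw [hq2, ← pow_mul]; exact (hqpow (by norm_num)).trans hqsq)
  rw [hq2] at hr1
  have hr2 := abs_inv_sinh_sub_le (x := 3 * (Real.pi * m)) (by positivity)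
    (by rw [hq3, ← pow_mul]; exact (hqpow (by norm_num)).trans hqsq)
  rw [hq3] at hr2
  set s := Real.sin (Real.pi * y) with hs
  set s' := Real.sin (Real.pi * y') with hs'
  set s2 := Real.sin (2 * (Real.pi * y)) with hs2
  set s2' := Real.sin (2 * (Real.pi * y')) with hs2'
  set s3 := Real.sin (3 * (Real.pi * y)) with hs3
  set s3' := Real.sin (3 * (Real.pi * y')) with hs3'
  have has : |s| ≤ 1 := Real.abs_sin_le_one _
  have has' : |s'| ≤ 1 := Real.abs_sin_le_one _
  have has2 : |s2| ≤ 1 := Real.abs_sin_le_one _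
  have has2' : |s2'| ≤ 1 := Real.abs_sin_le_one _
  have has3 : |s3| ≤ 1 := Real.abs_sin_le_one _
  have has3' : |s3'| ≤ 1 := Real.abs_sin_le_one _
  have e0 : |f 0 - 2 * q * s * s' * (1 + q ^ 2)| ≤ 4 * q ^ 4 := by
    rw [hf0]
    have hid : s * s' * (Real.sinh (Real.pi * m))⁻¹ - 2 * q * s * s' * (1 + q ^ 2) =
        s * s' * ((Real.sinh (Real.pi * m))⁻¹ - 2 * q - 2 * q ^ 3) := by ring
    rw [hid, abs_mul, abs_mul]
    calc |s| * |s'| * |(Real.sinh (Real.pi * m))⁻¹ - 2 * q - 2 * q ^ 3| ≤ 1 * 1 * (4 * q ^ 5) := by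
          gcongr
      _ = 4 * q ^ 5 := by ring
      _ ≤ 4 * q ^ 4 := by linarith [hqpow (show 4 ≤ 5 by norm_num)]
  have e1 : |f 1 - 4 * q ^ 2 * s2 * s2'| ≤ 8 * q ^ 4 := by
    rw [hf1]
    have hid : 2 * s2 * s2' * (Real.sinh (2 * (Real.pi * m)))⁻¹ - 4 * q ^ 2 * s2 * s2' =
        2 * (s2 * s2' * ((Real.sinh (2 * (Real.pi * m)))⁻¹ - 2 * q ^ 2)) := by ring
    rw [hid, abs_mul, abs_mul, abs_mul, abs_two]
    calc 2 * (|s2| * |s2'| * |(Real.sinh (2 * (Real.pi * m)))⁻¹ - 2 * q ^ 2|) ≤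
        2 * (1 * 1 * (4 * (q ^ 2) ^ 3)) := by gcongr
      _ = 8 * q ^ 6 := by ring
      _ ≤ 8 * q ^ 4 := by linarith [hqpow (show 4 ≤ 6 by norm_num)]
  have e2 : |f 2 - 6 * q ^ 3 * s3 * s3'| ≤ 12 * q ^ 4 := by
    rw [hf2]
    have hid : 3 * s3 * s3' * (Real.sinh (3 * (Real.pi * m)))⁻¹ - 6 * q ^ 3 * s3 * s3' =
        3 * (s3 * s3' * ((Real.sinh (3 * (Real.pi * m)))⁻¹ - 2 * q ^ 3)) := by ring
    rw [hid, abs_mul, abs_mul, abs_mul, show |(3 : ℝ)| = 3 by norm_num]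
    calc 3 * (|s3| * |s3'| * |(Real.sinh (3 * (Real.pi * m)))⁻¹ - 2 * q ^ 3|) ≤
        3 * (1 * 1 * (4 * (q ^ 3) ^ 3)) := by gcongr
      _ = 12 * q ^ 9 := by ring
      _ ≤ 12 * q ^ 4 := by linarith [hqpow (show 4 ≤ 9 by norm_num)]
  rw [hdecomp]
  calc |f 0 + f 1 + f 2 + ∑' i, f (i + 3) -
        (2 * q * s * s' * (1 + q ^ 2) + 4 * q ^ 2 * s2 * s2' + 6 * q ^ 3 * s3 * s3')|
      = |(f 0 - 2 * q * s * s' * (1 + q ^ 2)) + (f 1 - 4 * q ^ 2 * s2 * s2') +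
          (f 2 - 6 * q ^ 3 * s3 * s3') + ∑' i, f (i + 3)| := by
        congr 1; ring
    _ ≤ |f 0 - 2 * q * s * s' * (1 + q ^ 2)| + |f 1 - 4 * q ^ 2 * s2 * s2'| +
          |f 2 - 6 * q ^ 3 * s3 * s3'| + |∑' i, f (i + 3)| := by
        refine (abs_add_le _ _).trans ?_
        gcongr
        refine (abs_add_le _ _).trans ?_
        gcongr
        exact abs_add_le _ _
    _ ≤ 4 * q ^ 4 + 8 * q ^ 4 + 12 * q ^ 4 + 40 * q ^ 4 := by gcongr
    _ = 64 * q ^ 4 := by ring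

end Summit.CriticalPhenomena.SAWScalingLimit.Theorems
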